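import Literature.Computability.AlgebraicComplexity.DDS21EpsIntegralGraded
import Literature.Computability.AlgebraicComplexity.DDS21BorderBaseChange
import Literature.RingTheory.MvPolynomial.DirectionalShift
import HarnessLib

/-!
# Dutta–Dwivedi–Saxena 2021, §3: initial forms of shifted universal polynomials are `ε`-units
# at the transcendental point (E4.5, first half)

Topic `Literature/Computability/AlgebraicComplexity` (cell `val-lit`, row X2-DDS21, brick "B4c (E4.5a)" of
the `DDS2021_thm_3_2` programme; architecture of record (A′), lead-np RULING (143)(b): the random
point is the tuple of indeterminates `y`, the transcript runs over `F′ ⊇ F[y]`). Source: P. Dutta,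
P. Dwivedi, N. Saxena, *Demystifying the border of depth-3 algebraic circuits*, FOCS 2021
[DuttaDwivediSaxena2022], held full version `paper:galaxy-pdf-7641649743695546420`.

The printed proof needs, at every DiDIL stage, that "`z`-order data at the shifted point behave
generically": "`Φ(T_{i,0})|_{x=0} = T_{i,0}(α) ≠ 0`" (p0028 L753–754), "`(Φ(f₀)/T̃)|_{ε=0} = Φ(f₀)/t`"
(p0029 L777–779), "the valuation with respect to `z` and `ε` is non-negative" (p0035 L935–936).
In the graded frame this is the hypothesis `redZero (initialForm E) ≠ 0` of
`EpsLim.gradeZero_of_model` (`DDS21EpsIntegralGraded.lean`). This file DISCHARGES that hypothesis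
for every polynomial of the form `N = Ñ(x, y + x)` with `Ñ ∈ F[ε][x ⊔ y]` `x`-weighted-homogeneous
and `ε`-primitive, when `y` is the transcendental point:

* `ldeg_eq_of_homogeneousComponent` / `initialForm_eq_of_homogeneousComponent` — recognising
  `ldeg`/`initialForm` (p1's `DDS21GradedFractions.lean`) from vanishing components below `d` and
  a nonzero component in degree `d`;
* `ldeg_shift` / `initialForm_shift` — for `P` of `x`-weight `d` with `P(x, α) ≠ 0`:
  `ldeg P(x, α+x) = d` and `in(P(x, α+x)) = P(x, α)` (from `DirShift.homogeneousComponent_shift_eq_spec`);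
* `spec_algebraMap_injective` — at the TRANSCENDENTAL point `y` (any `F′` with injective
  `F[y] → F′`), `P ↦ P(x, y)` is injective on polynomials with coefficients in `F`;
* ★ `redZero_initialForm_shift_ne_zero` — for `Ñ ∈ F[ε][x ⊔ y]` of `x`-weight `d` with `Ñ(ε=0) ≠ 0`,
  the shifted model `N := Ñ^{ι}(x, y + x) ∈ F′[ε][x]` has `ldeg N = d` and an `ε`-UNIT initial
  form: `redZero (initialForm N) ≠ 0`; products `redZero_initialForm_mul_ne_zero`.

What is NOT here: that B4b's `denPoly`/`numPoly` ARE such shifted models (the companion-transcript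
naturality, E4.4) and the `w_j` assembly (E4.5b).

Honest framing: bookkeeping for the genericity step; `DDS2021_thm_3_2`/`DDS2021_thm_5_1` remain
named facts; VP ≠ VNP is NOT proved and nothing here bears on it.

## References

* [DuttaDwivediSaxena2022] P. Dutta, P. Dwivedi, N. Saxena, *Demystifying the border of depth-3
  algebraic circuits*, Proc. 62nd FOCS (2021), IEEE 2022, 92–103; full version: the map `Φ` and the
  random point `α` p0028 L751–757, Claim 3.4 proof p0029 L772–779, Claim 3.5 p0031 L819–834,
  Claim 3.8 proof p0035 L934–941.
-/

noncomputable section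

open MvPolynomial
open scoped BigOperators Polynomial

namespace Literature.Computability.AlgebraicComplexity

namespace DDS2021

open Literature.RingTheory.MvPolynomial

/-! ### Recognising `ldeg` / `initialForm` from homogeneous components -/

section Recognise

variable {σ : Type*} {R : Type*} [CommSemiring R]

/-- If all components of `P` below degree `d` vanish and the degree-`d` component does not, then
`ldeg P = d`. [cite: DuttaDwivediSaxena2022, §3 induction hypotheses (1)–(3) (full version p0030 L799–805)] -/
theorem ldeg_eq_of_homogeneousComponent {P : MvPolynomial σ R} {d : ℕ}
    (hlt : ∀ e < d, homogeneousComponent e P = 0) (hd : homogeneousComponent d P ≠ 0) :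
    ldeg P = d := by
  have hP : P ≠ 0 := fun h => hd (by rw [h, map_zero])
  apply le_antisymm
  · obtain ⟨m, hm⟩ := MvPolynomial.exists_coeff_ne_zero hd
    rw [coeff_homogeneousComponent] at hm
    by_cases hmd : m.degree = d
    · rw [if_pos hmd] at hm
      exact hmd ▸ ldeg_le_of_coeff_ne_zero hm
    · rw [if_neg hmd] at hm
      exact absurd rfl hm
  · refine le_ldeg_of_coeff_eq_zero hP fun m hm => ?_
    have h := congrArg (coeff m) (hlt m.degree hm)
    rwa [coeff_homogeneousComponent, if_pos rfl, coeff_zero] at h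

/-- Under the same hypotheses the initial form is the degree-`d` component.
[cite: DuttaDwivediSaxena2022, §3 induction hypotheses (1)–(3) (full version p0030 L799–805)] -/
theorem initialForm_eq_of_homogeneousComponent {P : MvPolynomial σ R} {d : ℕ}
    (hlt : ∀ e < d, homogeneousComponent e P = 0) (hd : homogeneousComponent d P ≠ 0) :
    initialForm P = homogeneousComponent d P := by
  rw [initialForm, ldeg_eq_of_homogeneousComponent hlt hd]

end Recognise

/-! ### `ldeg` and initial form of a shifted `x`-weighted-homogeneous polynomial -/

section Shift

variable {σ : Type*} [Fintype σ] {R : Type*} [CommSemiring R]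

/-- **`ldeg P(x, α + x) = d`** for `P(x, y)` of `x`-weight `d` with `P(x, α) ≠ 0` (the `z`-order of
a shifted term is the order datum, EXACTLY when the specialised universal term is nonzero).
[cite: DuttaDwivediSaxena2022, §3 the map Φ "Φ(T_{i,0})|_{x=0} = T_{i,0}(α) ≠ 0" (full version p0028 L753–754)] -/
theorem ldeg_shift (α : σ → R) {P : MvPolynomial (σ ⊕ σ) R} {d : ℕ}
    (h : IsWeightedHomogeneous (DirShift.xWeight σ) P d) (hne : DirShift.spec R α P ≠ 0) :
    ldeg (DirShift.shift R α P) = d :=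
  ldeg_eq_of_homogeneousComponent (fun _ he => DirShift.homogeneousComponent_shift_eq_zero α h he)
    (by rwa [DirShift.homogeneousComponent_shift_eq_spec α h])

/-- **`in(P(x, α + x)) = P(x, α)`** for `P` of `x`-weight `d` with `P(x, α) ≠ 0`.
[cite: DuttaDwivediSaxena2022, §3 the map Φ (full version p0028 L753–754); Claim 3.5 "similar argument" (p0031 L819–834)] -/
theorem initialForm_shift (α : σ → R) {P : MvPolynomial (σ ⊕ σ) R} {d : ℕ}
    (h : IsWeightedHomogeneous (DirShift.xWeight σ) P d) (hne : DirShift.spec R α P ≠ 0) :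
    initialForm (DirShift.shift R α P) = DirShift.spec R α P := by
  rw [initialForm_eq_of_homogeneousComponent
      (fun _ he => DirShift.homogeneousComponent_shift_eq_zero α h he)
      (by rwa [DirShift.homogeneousComponent_shift_eq_spec α h]),
    DirShift.homogeneousComponent_shift_eq_spec α h]

end Shift

/-! ### The transcendental point: `P ↦ P(x, y)` is injective -/

section Transcendental

variable {σ : Type*} {F : Type*} [CommSemiring F] {F' : Type*} [CommSemiring F']
  [Algebra F F'] [Algebra (MvPolynomial σ F) F'] [IsScalarTower F (MvPolynomial σ F) F']

/-- **Specialising at the transcendental point factors through `sumAlgEquiv`**: reading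
`P ∈ F[x ⊔ y]` in `F′[x]` by `y ↦ y` (the images of the indeterminates in `F′ ⊇ F[y]`) is
`map (F[y] → F′) ∘ sumAlgEquiv`. [cite: DuttaDwivediSaxena2022, §3 "α_i are random elements of F" (full version p0028 L751–754)] -/
theorem spec_map_algebraMap_eq (P : MvPolynomial (σ ⊕ σ) F) :
    DirShift.spec F' (fun l => algebraMap (MvPolynomial σ F) F' (X l)) (map (algebraMap F F') P) =
      map (algebraMap (MvPolynomial σ F) F') (sumAlgEquiv F σ σ P) := by
  induction P using MvPolynomial.induction_on with
  | C a =>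
    rw [map_C, DirShift.spec_C, sumAlgEquiv_C_inl, map_C,
      IsScalarTower.algebraMap_apply F (MvPolynomial σ F) F' a, MvPolynomial.algebraMap_eq]
  | add p q hp hq =>
    rw [map_add, map_add, hp, hq, map_add, map_add]
  | mul_X p s hp =>
    rw [map_mul, map_mul, hp, map_mul, map_mul]
    congr 1
    rcases s with l | l
    · rw [map_X, DirShift.spec_X_inl, sumAlgEquiv_X_inl, map_X]
    · rw [map_X, DirShift.spec_X_inr, sumAlgEquiv_X_inr, map_C]

/-- ★ **At the transcendental point, specialisation is injective**: if `F[y] → F′` is injective then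
`P(x, y) = 0 ⇒ P = 0` for `P` with coefficients in `F` — every "`P(α) ≠ 0` for random `α`" of the
printed proof holds AUTOMATICALLY at `α = y`. [cite: DuttaDwivediSaxena2022, §3 "α_i are random elements of F, such that … ≠ 0" (full version p0028 L751–754)] -/
theorem spec_map_algebraMap_ne_zero
    (hinj : Function.Injective (algebraMap (MvPolynomial σ F) F'))
    {P : MvPolynomial (σ ⊕ σ) F} (hP : P ≠ 0) :
    DirShift.spec F' (fun l => algebraMap (MvPolynomial σ F) F' (X l)) (map (algebraMap F F') P) ≠ 0 := by
  rw [spec_map_algebraMap_eq, Ne, map_eq_zero_iff _ (map_injective _ hinj),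
    EmbeddingLike.map_eq_zero_iff]
  exact hP

end Transcendental

/-! ### `ε`-unit initial forms of shifted integral models at the transcendental point -/

section EpsUnit

variable {σ : Type*} [Fintype σ] {F : Type*} [Field F] {F' : Type*} [Field F']
  [Algebra F F'] [Algebra (MvPolynomial σ F) F'] [IsScalarTower F (MvPolynomial σ F) F']

/-- The transcendental point read in `F′[ε]` (constants in `ε`): `y_l ↦ C (y_l)`.
[cite: DuttaDwivediSaxena2022, §3 the map Φ (full version p0028 L751–757)] -/
def epsPoint (σ F F' : Type*) [CommSemiring F] [CommSemiring F'] [Algebra (MvPolynomial σ F) F'] :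
    σ → F'[X] :=
  fun l => Polynomial.C (algebraMap (MvPolynomial σ F) F' (X l))

omit [Fintype σ] [Algebra F F'] [IsScalarTower F (MvPolynomial σ F) F'] in
/-- Reduction at `ε = 0` of the `F′[ε]`-valued point is the point. [cite: DuttaDwivediSaxena2022, §3 the map Φ (full version p0028 L751–757)] -/
theorem constantCoeff_comp_epsPoint :
    (Polynomial.constantCoeff : F'[X] →+* F') ∘ epsPoint σ F F' =
      fun l => algebraMap (MvPolynomial σ F) F' (X l) := by
  funext l
  simp [epsPoint]

/-- ★ **Shifted `ε`-primitive `x`-homogeneous models have `ε`-unit initial forms at the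
transcendental point.** For `Ñ ∈ F[ε][x ⊔ y]` of `x`-weight `d` with `Ñ(ε = 0) ≠ 0`, its shift
`N := Ñ^{ι}(x, y + x) ∈ F′[ε][x]` (`ι : F[ε] → F′[ε]`, `y` the transcendental point) satisfies
`ldeg N = d`, `in(N) = Ñ^{ι}(x, y)` and `redZero (in N) ≠ 0` — the hypothesis of
`EpsLim.gradeZero_of_model`. This is the graded-frame content of "for random `α` … the valuation
with respect to `z` and `ε` is non-negative".
[cite: DuttaDwivediSaxena2022, Claim 3.8 proof (full version p0035 L935–936); §3 the map Φ (p0028 L751–757)] -/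
theorem redZero_initialForm_shift_ne_zero
    (hinj : Function.Injective (algebraMap (MvPolynomial σ F) F'))
    {Ntilde : MvPolynomial (σ ⊕ σ) F[X]} {d : ℕ}
    (hhom : IsWeightedHomogeneous (DirShift.xWeight σ) Ntilde d)
    (hprim : redZero F (σ ⊕ σ) Ntilde ≠ 0) :
    ldeg (DirShift.shift F'[X] (epsPoint σ F F')
        (map (Polynomial.mapRingHom (algebraMap F F')) Ntilde)) = d ∧
      initialForm (DirShift.shift F'[X] (epsPoint σ F F')
        (map (Polynomial.mapRingHom (algebraMap F F')) Ntilde)) =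
        DirShift.spec F'[X] (epsPoint σ F F') (map (Polynomial.mapRingHom (algebraMap F F')) Ntilde) ∧
      redZero F' σ (initialForm (DirShift.shift F'[X] (epsPoint σ F F')
        (map (Polynomial.mapRingHom (algebraMap F F')) Ntilde))) ≠ 0 := by
  -- the mapped model is still `x`-weighted-homogeneous
  have hhom' : IsWeightedHomogeneous (DirShift.xWeight σ)
      (map (Polynomial.mapRingHom (algebraMap F F')) Ntilde) d := by
    intro m hm
    rw [coeff_map] at hm
    exact hhom (fun h0 => hm (by rw [h0, map_zero]))
  -- its specialisation at `y` is nonzero, because its reduction at `ε = 0` is the (injective)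
  -- specialisation of the reduction of `Ñ`
  have hred : redZero F' σ (DirShift.spec F'[X] (epsPoint σ F F')
      (map (Polynomial.mapRingHom (algebraMap F F')) Ntilde)) =
      DirShift.spec F' (fun l => algebraMap (MvPolynomial σ F) F' (X l))
        (map (algebraMap F F') (redZero F (σ ⊕ σ) Ntilde)) := by
    rw [redZero_apply, DirShift.map_spec, constantCoeff_comp_epsPoint, map_map,
      constantCoeff_comp_mapRingHom, ← map_map, ← redZero_apply]
  have hspec : DirShift.spec F'[X] (epsPoint σ F F')
      (map (Polynomial.mapRingHom (algebraMap F F')) Ntilde) ≠ 0 := by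
    intro h0
    have h1 := congrArg (redZero F' σ) h0
    rw [hred, map_zero] at h1
    exact spec_map_algebraMap_ne_zero hinj hprim h1
  refine ⟨ldeg_shift _ hhom' hspec, initialForm_shift _ hhom' hspec, ?_⟩
  rw [initialForm_shift _ hhom' hspec, hred]
  exact spec_map_algebraMap_ne_zero hinj hprim

omit [Fintype σ] in
/-- Products of models with `ε`-unit initial forms have `ε`-unit initial forms (`F′[ε][x]` and
`F′[x]` are domains). [cite: DuttaDwivediSaxena2022, Claim 3.8 proof (full version p0035 L935–939)] -/
theorem redZero_initialForm_mul_ne_zero {M N : MvPolynomial σ F'[X]}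
    (hM : redZero F' σ (initialForm M) ≠ 0) (hN : redZero F' σ (initialForm N) ≠ 0) :
    redZero F' σ (initialForm (M * N)) ≠ 0 := by
  rw [initialForm_mul, map_mul]
  exact mul_ne_zero hM hN

omit [Fintype σ] in
/-- Finite products. [cite: DuttaDwivediSaxena2022, Claim 3.8 proof (full version p0035 L935–939)] -/
theorem redZero_initialForm_prod_ne_zero {ι : Type*} (s : Finset ι) {M : ι → MvPolynomial σ F'[X]}
    (h : ∀ i ∈ s, redZero F' σ (initialForm (M i)) ≠ 0) :
    redZero F' σ (initialForm (∏ i ∈ s, M i)) ≠ 0 := by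
  classical
  induction s using Finset.induction_on with
  | empty =>
    rw [Finset.prod_empty, initialForm_eq_self_of_isHomogeneous (isHomogeneous_one σ _) one_ne_zero,
      map_one]
    exact one_ne_zero
  | insert a s ha ih =>
    rw [Finset.prod_insert ha]
    exact redZero_initialForm_mul_ne_zero (h a (Finset.mem_insert_self a s))
      (ih fun i hi => h i (Finset.mem_insert_of_mem hi))

end EpsUnit

end DDS2021

end Literature.Computability.AlgebraicComplexity

end
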